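import Literature.Analysis.PDE.HeatFreeFlowAdmissible
import HarnessLib

/-!
# Cut-off calculus: derivatives of `χ • g` for a compactly supported cut-off and a function
# smooth only near its support (topic `Analysis/PDE`)

Analytic layer of the programme to prove short-time existence for quasilinear strictly
parabolic systems on a closed manifold (hypothesis `hQL` of
`Literature.Geometry.Riemannian.ricciFlow_shortTime_existence_of_quasilinear`). Chart expressions
`v̂ = v ∘ ψ` of functions on the manifold are smooth only on the (open) chart image `V`; they
enter the flat heat engine of the programme through the globally defined cut-off products
`w = χ • v̂` with `tsupport χ ⊆ V`. This file is the calculus of such products: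

* `contDiff_smul_of_tsupport_subset` — `χ • g` is smooth on the whole space;
* `fderiv_smul_of_tsupport_subset_apply` — `∂ᵤ(χ • g) = χ • ∂ᵤg + (∂ᵤχ) • g` EVERYWHERE
  (off `V` both sides vanish);
* `fderiv_fderiv_smul_of_tsupport_subset_apply` — the second-order Leibniz rule
  `∂ᵤ∂ᵥ(χ • g) = χ • ∂ᵤ∂ᵥg + (∂ᵤχ) • ∂ᵥg + (∂ᵥχ) • ∂ᵤg + (∂ᵤ∂ᵥχ) • g`;
* `laplacian_smul_of_tsupport_subset` — in the standard frame,
  `Δ(χ • g) = χ • Σₗ∂ₗ∂ₗg + 2 Σₗ (∂ₗχ) • ∂ₗg + (Δχ) • g`;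
* `sum_sum_smul_fderiv_fderiv_smul` — the same expansion for a second-order operator in frame
  form `Σₖₗ mₖₗ • ∂ₖ∂ₗ` (the chart form of the principal part of a parabolic system with scalar
  symbol), which produces the residual identity of the a priori estimates of the programme.

Everything is proved; no named fact and no `sorry` is introduced.

## References

* L. C. Evans, *Partial Differential Equations*, 2nd ed., AMS 2010, §6.3.1 (proof of Thm. 1:
  the cut-off function calculus of interior regularity). [Evans2010]
-/

noncomputable section

open MeasureTheory Set Function Filter Topology TopologicalSpace Metric InnerProductSpace
open scoped RealInnerProductSpace Laplacian ContDiff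

namespace Literature.Analysis.PDE

open Literature.Analysis.FunctionSpaces

variable {E : Type*} [NormedAddCommGroup E] [NormedSpace ℝ E]
variable {F : Type*} [NormedAddCommGroup F] [NormedSpace ℝ F]
variable {χ : E → ℝ} {g : E → F} {V : Set E}

/-! ### Smoothness and first derivatives -/

section First

/-- A cut-off product `χ • g` with `tsupport χ ⊆ V`, `V` open, `g` smooth on `V`, is smooth on the
whole space. [folklore] -/
theorem contDiff_smul_of_tsupport_subset (hV : IsOpen V) (hχ : ContDiff ℝ ∞ χ)
    (hχV : tsupport χ ⊆ V) (hg : ContDiffOn ℝ ∞ g V) : ContDiff ℝ ∞ fun x ↦ χ x • g x := by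
  refine contDiff_iff_contDiffAt.2 fun x ↦ ?_
  by_cases hx : x ∈ V
  · exact (hχ.contDiffOn.smul hg).contDiffAt (hV.mem_nhds hx)
  · have hx' : x ∉ tsupport χ := fun h ↦ hx (hχV h)
    rw [notMem_tsupport_iff_eventuallyEq] at hx'
    have hev : (fun x ↦ χ x • g x) =ᶠ[𝓝 x] fun _ ↦ 0 := by
      filter_upwards [hx'] with z hz
      simp [hz]
    exact (contDiffAt_const (c := (0 : F))).congr_of_eventuallyEq hev

/-- Off the support of the cut-off, the cut-off and its derivative vanish. [folklore] -/
theorem eq_zero_of_notMem_tsupport (χ : E → ℝ) {x : E} (hx : x ∉ tsupport χ) :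
    χ x = 0 ∧ fderiv ℝ χ x = 0 :=
  ⟨image_eq_zero_of_notMem_tsupport hx, fderiv_of_notMem_tsupport ℝ hx⟩

/-- **First-order Leibniz rule for cut-off products**, valid everywhere:
`∂ᵤ(χ • g) = χ • ∂ᵤg + (∂ᵤχ) • g`. [folklore] -/
theorem fderiv_smul_of_tsupport_subset_apply (hV : IsOpen V) (hχ : ContDiff ℝ ∞ χ)
    (hχV : tsupport χ ⊆ V) (hg : ContDiffOn ℝ ∞ g V) (x u : E) :
    fderiv ℝ (fun x ↦ χ x • g x) x u = χ x • fderiv ℝ g x u + fderiv ℝ χ x u • g x := by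
  by_cases hx : x ∈ V
  · have hχx : DifferentiableAt ℝ χ x := (hχ.differentiable (by simp)) x
    have hgx : DifferentiableAt ℝ g x :=
      (hg.differentiableOn (by simp) x hx).differentiableAt (hV.mem_nhds hx)
    rw [fderiv_fun_smul hχx hgx]
    simp [ContinuousLinearMap.smulRight_apply]
  · have hx' : x ∉ tsupport χ := fun h ↦ hx (hχV h)
    obtain ⟨h0, h1⟩ := eq_zero_of_notMem_tsupport χ hx'
    have hx'' : x ∉ tsupport fun x ↦ χ x • g x := fun h ↦ hx' (tsupport_smul_subset_left χ g h)
    rw [fderiv_of_notMem_tsupport ℝ hx'', h0, h1]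
    simp

/-- Function form of the first-order Leibniz rule. [folklore] -/
theorem fderiv_smul_of_tsupport_subset_eq (hV : IsOpen V) (hχ : ContDiff ℝ ∞ χ)
    (hχV : tsupport χ ⊆ V) (hg : ContDiffOn ℝ ∞ g V) (u : E) :
    (fun x ↦ fderiv ℝ (fun x ↦ χ x • g x) x u) =
      fun x ↦ χ x • fderiv ℝ g x u + fderiv ℝ χ x u • g x :=
  funext fun x ↦ fderiv_smul_of_tsupport_subset_apply hV hχ hχV hg x u

/-- The directional derivative of the cut-off is a cut-off with the same support control.
[folklore] -/
theorem tsupport_fderiv_apply_subset_of_subset (hχV : tsupport χ ⊆ V) (u : E) :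
    tsupport (fun x ↦ fderiv ℝ χ x u) ⊆ V :=
  (tsupport_fderiv_apply_subset ℝ u).trans hχV

/-- The directional derivative of the cut-off is smooth. This is the tree's
`Literature.Analysis.FluidPDE.contDiff_fderiv_apply_const` (`FluidPDE/SpaceTimeMollifier`); the
name is kept as a one-line restatement because `PDE/InteriorW16Bound`,
`PDE/FlatLocalResidual` and `PDE/PatchResidualEnergy` use it (dedup-00763). [folklore] -/
theorem contDiff_fderiv_apply_of_contDiff (hχ : ContDiff ℝ ∞ χ) (u : E) :
    ContDiff ℝ ∞ fun x ↦ fderiv ℝ χ x u :=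
  FluidPDE.contDiff_fderiv_apply_const hχ u

/-- A directional derivative of a function smooth on an open set is smooth there. [folklore] -/
theorem contDiffOn_fderiv_apply_of_isOpen (hV : IsOpen V) (hg : ContDiffOn ℝ ∞ g V) (u : E) :
    ContDiffOn ℝ ∞ (fun x ↦ fderiv ℝ g x u) V :=
  (hg.fderiv_of_isOpen hV (by simp)).clm_apply contDiffOn_const

end First

/-! ### Second derivatives, the Laplacian, frame-form operators -/

section Second

/-- **Second-order Leibniz rule for cut-off products**, valid everywhere:
`∂ᵤ∂ᵥ(χ • g) = χ • ∂ᵤ∂ᵥg + (∂ᵤχ) • ∂ᵥg + (∂ᵥχ) • ∂ᵤg + (∂ᵤ∂ᵥχ) • g`. [folklore] -/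
theorem fderiv_fderiv_smul_of_tsupport_subset_apply (hV : IsOpen V) (hχ : ContDiff ℝ ∞ χ)
    (hχV : tsupport χ ⊆ V) (hg : ContDiffOn ℝ ∞ g V) (x u v : E) :
    fderiv ℝ (fun z ↦ fderiv ℝ (fun y ↦ χ y • g y) z v) x u =
      χ x • fderiv ℝ (fun z ↦ fderiv ℝ g z v) x u +
        fderiv ℝ χ x u • fderiv ℝ g x v + fderiv ℝ χ x v • fderiv ℝ g x u +
          fderiv ℝ (fun z ↦ fderiv ℝ χ z v) x u • g x := by
  rw [fderiv_smul_of_tsupport_subset_eq hV hχ hχV hg v]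
  -- both summands are globally smooth cut-off products
  have h1 : ContDiff ℝ ∞ fun z ↦ χ z • fderiv ℝ g z v :=
    contDiff_smul_of_tsupport_subset hV hχ hχV (contDiffOn_fderiv_apply_of_isOpen hV hg v)
  have h2 : ContDiff ℝ ∞ fun z ↦ fderiv ℝ χ z v • g z :=
    contDiff_smul_of_tsupport_subset hV (FluidPDE.contDiff_fderiv_apply_const hχ v)
      (tsupport_fderiv_apply_subset_of_subset hχV v) hg
  rw [fderiv_fun_add ((h1.differentiable (by simp)) x) ((h2.differentiable (by simp)) x),
    add_apply,
    fderiv_smul_of_tsupport_subset_apply hV hχ hχV (contDiffOn_fderiv_apply_of_isOpen hV hg v) x u,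
    fderiv_smul_of_tsupport_subset_apply hV (FluidPDE.contDiff_fderiv_apply_const hχ v)
      (tsupport_fderiv_apply_subset_of_subset hχV v) hg x u]
  abel

variable {E' : Type*} [NormedAddCommGroup E'] [InnerProductSpace ℝ E'] [FiniteDimensional ℝ E']
variable {χ' : E' → ℝ} {g' : E' → F} {V' : Set E'}

/-- **The Laplacian of a cut-off product** in the standard frame `(eₗ)`:
`Δ(χ • g) = χ • Σₗ ∂ₗ∂ₗg + 2 Σₗ (∂ₗχ) • ∂ₗg + (Δχ) • g` (everywhere; the frame Laplacian of
`g` is written as the sum of its second frame derivatives, `g` being smooth only on `V`).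
[cite: Evans2010, §6.3.1] -/
theorem laplacian_smul_of_tsupport_subset (hV : IsOpen V') (hχ : ContDiff ℝ ∞ χ')
    (hχV : tsupport χ' ⊆ V') (hg : ContDiffOn ℝ ∞ g' V') (x : E') :
    (Δ (fun y ↦ χ' y • g' y)) x =
      χ' x • ∑ l, fderiv ℝ (fun z ↦ fderiv ℝ g' z (stdOrthonormalBasis ℝ E' l)) x
          (stdOrthonormalBasis ℝ E' l) +
        2 • ∑ l, fderiv ℝ χ' x (stdOrthonormalBasis ℝ E' l) •
          fderiv ℝ g' x (stdOrthonormalBasis ℝ E' l) +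
        (Δ χ') x • g' x := by
  set b := stdOrthonormalBasis ℝ E'
  have hs : ContDiff ℝ ∞ fun y ↦ χ' y • g' y := contDiff_smul_of_tsupport_subset hV hχ hχV hg
  rw [Literature.Analysis.FluidPDE.laplacian_eq_sum_fderiv_fderiv_normed b (hs.of_le (by norm_cast)),
    Literature.Analysis.FluidPDE.laplacian_eq_sum_fderiv_fderiv_normed b (hχ.of_le (by norm_cast))]
  simp_rw [fderiv_fderiv_smul_of_tsupport_subset_apply hV hχ hχV hg x]
  rw [Finset.sum_add_distrib, Finset.sum_add_distrib, Finset.sum_add_distrib, ← Finset.smul_sum,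
    ← Finset.sum_smul, two_smul]
  abel

/-- **A second-order operator in frame form applied to a cut-off product**:
`Σₖₗ mₖₗ • ∂ₖ∂ₗ(χ • g) = χ • Σₖₗ mₖₗ • ∂ₖ∂ₗg + Σₖₗ mₖₗ • ((∂ₖχ) • ∂ₗg + (∂ₗχ) • ∂ₖg)
  + (Σₖₗ mₖₗ ∂ₖ∂ₗχ) • g` (pointwise, everywhere). [cite: Evans2010, §6.3.1] -/
theorem sum_sum_smul_fderiv_fderiv_smul {ι : Type*} [Fintype ι] (e : ι → E) (m : ι → ι → ℝ)
    (hV : IsOpen V) (hχ : ContDiff ℝ ∞ χ) (hχV : tsupport χ ⊆ V) (hg : ContDiffOn ℝ ∞ g V)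
    (x : E) :
    ∑ k, ∑ l, m k l • fderiv ℝ (fun z ↦ fderiv ℝ (fun y ↦ χ y • g y) z (e l)) x (e k) =
      χ x • ∑ k, ∑ l, m k l • fderiv ℝ (fun z ↦ fderiv ℝ g z (e l)) x (e k) +
        ∑ k, ∑ l, m k l • (fderiv ℝ χ x (e k) • fderiv ℝ g x (e l) +
          fderiv ℝ χ x (e l) • fderiv ℝ g x (e k)) +
        (∑ k, ∑ l, m k l * fderiv ℝ (fun z ↦ fderiv ℝ χ z (e l)) x (e k)) • g x := by
  simp_rw [fderiv_fderiv_smul_of_tsupport_subset_apply hV hχ hχV hg x]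
  simp only [smul_add, Finset.sum_add_distrib, Finset.smul_sum, Finset.sum_smul, smul_smul,
    mul_comm (m _ _)]
  simp only [← smul_smul]
  abel

end Second

end Literature.Analysis.PDE

end
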